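import Summits.Ventures.PackingBounds.ThreePointCert.Soundness

/-!
# Kronecker-packed kernel validation of the Gram row chunks

Framing: lottery ticket; floor = certified bounds/negative ranges. Venture `PackingBounds`
(cell `pub-packcert`), three-point SDP family.

A much faster kernel program for the row-chunk validation `chunkOK` of
`Literature/…/KissingCertComp` (the expensive step of every kernel-checked three-point row).
Each row `r` of the integer Gram factor `L` (stored offset-encoded, entries `e + B : ℕ`) is packed
once per `decide` into `Σ r_k X^k`, `Σ r_l X^{n-1-l}`, the repunit `Σ_{e<n} X^e` and `X^{n-1}`
(`rowK`); every entry of `L Lᵀ` is then read off big-integer products by one division and one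
remainder (`extractK`; Kronecker substitution: the coefficient of `X^{n_b-1}` in
`(Σ_k a_k X^k)(Σ_l b_l X^{n_b-1-l})` is the prefix dot product `Σ_{k<min} a_k b_k` when no digit
carries occur — `kron_split`, `kron_extract`; the offset is removed with the same lemma applied to
all-ones rows, `dotK_eq`), so the kernel's GMP arithmetic does the multiply–adds.
Measured on the Lean farm (2026-08-20): the old `chunkOK` costs ≈ 0.3–0.6 ms per `ℤ` multiply–add
(d = 10 row ≈ 77 chunks / 70 files; d = 12 ≈ 330 chunks); here a 185-row block (34 225 entries of
`L Lᵀ`, 2.1·10⁶ multiply–adds) validates in one `decide` in ≈ 40 s, and the cell's complete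
κ(4) ≤ 24 certificate (n = 4, d = 7: all Gram blocks, `FI`, `(i')`, `(ii')`, bound, theorem)
re-checks end-to-end in a single 195 s run; chunks are sized by `(i, j)` pair terms (≈ 4·10⁴ per
`decide`). `chunkOKK g … = true` implies `chunkOK g.toGramBlk … = true` (`chunkOK_of_okK`, via
`quadRowsK_eq`), so `ThreePointCert.Soundness` applies unchanged to the decoded block
(`chunkVal_of_okK`, `rvalid_of_singleK`). No statement about certificates changes.
-/

noncomputable section

namespace Summit.Ventures.PackingBounds.ThreePointCert

open Literature.Geometry.DiscreteGeometry Literature.Geometry.DiscreteGeometry.PolyCert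
open Literature.Geometry.DiscreteGeometry.PolyCert.SPoly

/-! ### Kernel programs -/
/-- Forward packing `Σ_k r_k X^k` (one `List.rec` pass, primitive `ℕ` operations). -/
def packF (X : ℕ) (r : List ℕ) : ℕ :=
  r.rec (motive := fun _ => ℕ) 0 (fun d _ acc => Nat.add d (Nat.mul X acc))

/-- Reverse packing with accumulator: `packRA X r c = c·X^{|r|} + Σ_l r_l X^{|r|-1-l}`. -/
def packRA (X : ℕ) (r : List ℕ) : ℕ → ℕ :=
  r.rec (motive := fun _ => ℕ → ℕ) (fun acc => acc) (fun d _ ih acc => ih (Nat.add (Nat.mul acc X) d))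

/-- Reverse packing `Σ_l r_l X^{|r|-1-l}`. -/
def packR (X : ℕ) (r : List ℕ) : ℕ := packRA X r 0

/-- The repunit `Σ_{e<|r|} X^e` (packing of the all-ones row of the same length). -/
def repunit (X : ℕ) (r : List ℕ) : ℕ :=
  r.rec (motive := fun _ => ℕ) 0 (fun _ _ acc => Nat.add 1 (Nat.mul X acc))

/-- Packed data of one row. -/
structure RowK where
  /-- `Σ r_k X^k` -/
  pf : ℕ
  /-- `Σ r_l X^{n-1-l}` -/
  pr : ℕ
  /-- `Σ_{e<n} X^e` -/
  u : ℕ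
  /-- `X^{n-1}` -/
  dv : ℕ

/-- Pack one row. -/
def rowK (X : ℕ) (r : List ℕ) : RowK := ⟨packF X r, packR X r, repunit X r, Nat.pow X (r.length - 1)⟩

/-- Coefficient of `X^{n_b-1}` of the product `p · q` (with `dv = X^{n_b-1}`). -/
def extractK (X p q dv : ℕ) : ℕ := Nat.mod (Nat.div (Nat.mul p q) dv) X

/-- Decoded integer dot product of two offset-encoded rows from their packed data:
`Σ (a_k-B)(b_k-B) = Σ a_k b_k + n B² - B (Σ a_k + Σ b_k)` over the common prefix. -/
def dotK (X B BB : ℕ) (a b : RowK) : ℤ :=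
  Int.subNatNat (Nat.add (extractK X a.pf b.pr b.dv) (Nat.mul (extractK X a.u b.u b.dv) BB))
    (Nat.mul B (Nat.add (extractK X a.pf b.u b.dv) (extractK X a.u b.pr b.dv)))

/-- A Gram block with offset-encoded natural-number rows and a packing base `X`;
`BB` must be `B²`, all entries `< Dg`, `2 ≤ Dg`, and `2 · (max row length) · Dg² < X`
(checked by `GramBlkK.ok`). -/
structure GramBlkK where
  /-- basis monomials -/
  z : List Mono
  /-- packing base -/
  X : ℕ
  /-- offset: entry `x` stands for `x - B` -/
  B : ℕ
  /-- `B²` (data, checked) -/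
  BB : ℕ
  /-- digit bound (data, checked) -/
  Dg : ℕ
  /-- rows of the factor `L`, entries `e + B` -/
  L : List (List ℕ)

/-- Decode one offset row (`x ↦ x - B`). -/
def unoffset (B : ℕ) (r : List ℕ) : List ℤ := r.map fun (x : ℕ) => (x : ℤ) - (B : ℤ)

/-- The integer Gram block encoded by a packed block. -/
def GramBlkK.toGramBlk (g : GramBlkK) : GramBlk := ⟨g.z, g.L.map (unoffset g.B)⟩

/-- Maximal row length. -/
def maxLenN (L : List (List ℕ)) : ℕ := (L.map List.length).foldr max 0

/-- Side conditions of a packed block (lengths, `BB = B²`, digit bound, no-carry bound). -/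
def GramBlkK.ok (g : GramBlkK) : Bool :=
  (g.L.length == g.z.length) && (g.BB == g.B * g.B) && decide (2 ≤ g.X) && decide (2 ≤ g.Dg) &&
    (g.L.all fun r => r.all fun d => decide (d < g.Dg)) && decide (2 * maxLenN g.L * (g.Dg * g.Dg) < g.X)

/-- Rows `i0, …, i0+cnt-1` of the quadratic form `zᵀ(LLᵀ)z` from packed rows
(same term list as `quadRows g.toGramBlk i0 cnt`, see `quadRowsK_eq`). -/
def quadRowsK (g : GramBlkK) (i0 cnt : ℕ) : SPoly :=
  mergeAllB 16 (List.zipWith (fun (ai : RowK) (zi : Mono) =>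
      List.zipWith (fun (g' : ℤ) (zj : Mono) => (zi.mul zj, g'))
        ((g.L.map (rowK g.X)).map fun bj => dotK g.X g.B g.BB ai bj) g.z)
    (((g.L.map (rowK g.X)).drop i0).take cnt) ((g.z.drop i0).take cnt))

/-- Chunk check on packed data: side conditions and `Dprev + (rows i0 … i0+cnt-1) - Dnext ≡ 0`. -/
def chunkOKK (g : GramBlkK) (i0 cnt : ℕ) (Dprev Dnext : SPoly) : Bool :=
  g.ok && decide (i0 + cnt ≤ g.z.length) && residualBound (Dprev ++ quadRowsK g i0 cnt ++ neg Dnext) 0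

/-! ### Semantics of the packings -/
/-- Prefix dot product of two digit lists. -/
def dotP : List ℕ → List ℕ → ℕ
  | x :: a, y :: b => x * y + dotP a b
  | _, _ => 0

/-- The all-ones list of the same length. -/
def ones (r : List ℕ) : List ℕ := r.map fun _ => 1
/-- `packF []`. -/
@[simp] theorem packF_nil (X : ℕ) : packF X [] = 0 := rfl
/-- `packF (d :: r)`. -/
@[simp] theorem packF_cons (X d : ℕ) (r : List ℕ) : packF X (d :: r) = d + X * packF X r := rfl
/-- `repunit []`. -/
@[simp] theorem repunit_nil (X : ℕ) : repunit X [] = 0 := rfl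
/-- `repunit (d :: r)`. -/
@[simp] theorem repunit_cons (X d : ℕ) (r : List ℕ) : repunit X (d :: r) = 1 + X * repunit X r := rfl
/-- `packRA []`. -/
theorem packRA_nil (X acc : ℕ) : packRA X [] acc = acc := rfl
/-- `packRA (d :: r)`. -/
theorem packRA_cons (X d acc : ℕ) (r : List ℕ) : packRA X (d :: r) acc = packRA X r (acc * X + d) := rfl
/-- `dotP [] b = 0`. -/
@[simp] theorem dotP_nil_left (b : List ℕ) : dotP [] b = 0 := by cases b <;> rfl
/-- `dotP a [] = 0`. -/
@[simp] theorem dotP_nil_right (a : List ℕ) : dotP a [] = 0 := by cases a <;> rfl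
/-- `dotP` on two `cons`. -/
@[simp] theorem dotP_cons (x y : ℕ) (a b : List ℕ) : dotP (x :: a) (y :: b) = x * y + dotP a b := rfl
/-- `ones []`. -/
@[simp] theorem ones_nil : ones [] = [] := rfl
/-- `ones (d :: r)`. -/
@[simp] theorem ones_cons (d : ℕ) (r : List ℕ) : ones (d :: r) = 1 :: ones r := rfl
/-- `ones` preserves length. -/
@[simp] theorem length_ones (r : List ℕ) : (ones r).length = r.length := by simp [ones]
/-- Accumulator law of the reverse packing. -/
theorem packRA_eq (X : ℕ) (r : List ℕ) (acc : ℕ) : packRA X r acc = acc * X ^ r.length + packRA X r 0 := by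
  induction r generalizing acc with
  | nil => simp [packRA_nil]
  | cons d r ih =>
    rw [packRA_cons, packRA_cons, ih (acc * X + d), ih (0 * X + d), List.length_cons, pow_succ]
    ring
/-- `packR []`. -/
@[simp] theorem packR_nil (X : ℕ) : packR X [] = 0 := rfl
/-- `packR (d :: r) = d X^{|r|} + packR r`. -/
theorem packR_cons (X d : ℕ) (r : List ℕ) : packR X (d :: r) = d * X ^ r.length + packR X r := by
  unfold packR
  rw [packRA_cons, packRA_eq]
  simp
/-- The repunit is the forward packing of the all-ones row. -/
theorem repunit_eq_packF_ones (X : ℕ) (r : List ℕ) : repunit X r = packF X (ones r) := by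
  induction r with
  | nil => rfl
  | cons d r ih => simp [ih]
/-- `repunit (d :: r) = X^{|r|} + repunit r` (so it is also the reverse packing of the ones row). -/
theorem repunit_cons' (X d : ℕ) (r : List ℕ) : repunit X (d :: r) = X ^ r.length + repunit X r := by
  induction r generalizing d with
  | nil => simp
  | cons e r ih =>
    conv_lhs => rw [repunit_cons, ih e]
    rw [repunit_cons, List.length_cons, pow_succ]
    ring
/-- The repunit is the reverse packing of the all-ones row. -/
theorem repunit_eq_packR_ones (X : ℕ) (r : List ℕ) : repunit X r = packR X (ones r) := by
  induction r with
  | nil => rfl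
  | cons d r ih => rw [repunit_cons', ones_cons, packR_cons, length_ones, ih]; ring
/-- `repunit r · X + X ≤ 2 X^{|r|}` for `X ≥ 2` and `r ≠ []`. -/
theorem repunit_bound (X : ℕ) (hX : 2 ≤ X) (r : List ℕ) (hr : r ≠ []) :
    repunit X r * X + X ≤ 2 * X ^ r.length := by
  induction r with
  | nil => exact absurd rfl hr
  | cons d r ih =>
    rw [repunit_cons, List.length_cons, pow_succ]
    rcases r with _ | ⟨e, r'⟩
    · simp; nlinarith
    · have h := ih (List.cons_ne_nil e r'); rw [List.length_cons, pow_succ] at h ⊢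
      nlinarith [Nat.zero_le (repunit X (e :: r')), Nat.zero_le (X ^ r'.length)]
/-- `packR r ≤ (Dg-1) · repunit r` when all digits are `< Dg`. -/
theorem packR_le (X Dg : ℕ) (r : List ℕ) (hr : ∀ d ∈ r, d < Dg) : packR X r ≤ (Dg - 1) * repunit X r := by
  induction r with
  | nil => simp
  | cons d r ih =>
    have hd : d ≤ Dg - 1 := by have := hr d (by simp); omega
    have ih' := ih (fun e he => hr e (by simp [he]))
    rw [packR_cons, repunit_cons']
    nlinarith [Nat.zero_le (X ^ r.length)]
/-- `dotP a b ≤ |a| · Dg²` when all digits are `< Dg`. -/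
theorem dotP_le (Dg : ℕ) : ∀ (a b : List ℕ), (∀ d ∈ a, d < Dg) → (∀ d ∈ b, d < Dg) →
    dotP a b ≤ a.length * (Dg * Dg)
  | [], b, _, _ => by simp
  | x :: a, [], _, _ => by simp
  | x :: a, y :: b, ha, hb => by
    have hx : x < Dg := ha x (by simp)
    have hy : y < Dg := hb y (by simp)
    have ih := dotP_le Dg a b (fun d hd => ha d (by simp [hd])) (fun d hd => hb d (by simp [hd]))
    rw [dotP_cons, List.length_cons]
    nlinarith [Nat.mul_le_mul hx.le hy.le]

/-- **Kronecker substitution, no carries.** For digit lists `a`, `b ≠ []` with digits `< Dg` and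
`X ≥ 2`: `packF a · packR b = low + X^{|b|-1} (dotP a b + X · hi)` with
`low · X² ≤ 2 |a| Dg² X^{|b|}`. -/
theorem kron_split (X Dg : ℕ) (hX : 2 ≤ X) :
    ∀ (a b : List ℕ), (∀ d ∈ a, d < Dg) → (∀ d ∈ b, d < Dg) → b ≠ [] →
      ∃ low hi : ℕ, packF X a * packR X b = low + X ^ (b.length - 1) * (dotP a b + X * hi) ∧
        low * (X * X) ≤ 2 * a.length * (Dg * Dg) * X ^ b.length
  | [], b, _, _, _ => ⟨0, 0, by simp, by simp⟩
  | x :: a, [], _, _, h => absurd rfl h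
  | x :: a, [y], ha, hb, _ => by
    refine ⟨0, y * packF X a, ?_, by simp⟩
    rw [packF_cons, packR_cons, packR_nil, dotP_cons, dotP_nil_right]
    simp; ring
  | x :: a, y :: e :: b, ha, hb, _ => by
    have ha' : ∀ d ∈ a, d < Dg := fun d hd => ha d (by simp [hd])
    have hb' : ∀ d ∈ (e :: b), d < Dg := fun d hd => hb d (by simp at hd ⊢; tauto)
    obtain ⟨low', hi', hprod, hbound⟩ := kron_split X Dg hX a (e :: b) ha' hb' (List.cons_ne_nil e b)
    have hx : x < Dg := ha x (by simp)
    refine ⟨x * packR X (e :: b) + X * low', y * packF X a + hi', ?_, ?_⟩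
    · simp only [List.length_cons, Nat.add_sub_cancel] at hprod ⊢
      rw [packF_cons, packR_cons, dotP_cons, List.length_cons]
      have : (x + X * packF X a) * (y * X ^ (b.length + 1) + packR X (e :: b)) =
          x * packR X (e :: b) + X * (packF X a * packR X (e :: b)) + X ^ (b.length + 1) * (x * y) +
            X ^ (b.length + 1) * X * (y * packF X a) := by ring
      rw [this, hprod]; ring
    · -- bound: low·X² ≤ 2 |x::a| Dg² X^{|y::e::b|}
      have hR := repunit_bound X hX (e :: b) (List.cons_ne_nil e b)
      have hP := packR_le X Dg (e :: b) hb'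
      simp only [List.length_cons, pow_succ] at hbound hR ⊢
      have h1 : packR X (e :: b) * X ≤ (Dg - 1) * (2 * (X ^ b.length * X)) :=
        calc packR X (e :: b) * X ≤ (Dg - 1) * repunit X (e :: b) * X := Nat.mul_le_mul_right _ hP
          _ = (Dg - 1) * (repunit X (e :: b) * X) := by ring
          _ ≤ (Dg - 1) * (2 * (X ^ b.length * X)) := Nat.mul_le_mul_left _ (by omega)
      have hx' : x ≤ Dg - 1 := by omega
      have hDD : (Dg - 1) * (Dg - 1) ≤ Dg * Dg := Nat.mul_le_mul (Nat.sub_le _ _) (Nat.sub_le _ _)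
      have h2 : x * packR X (e :: b) * (X * X) ≤ 2 * (Dg * Dg) * (X ^ b.length * X * X) := by
        calc x * packR X (e :: b) * (X * X) = x * (packR X (e :: b) * X) * X := by ring
          _ ≤ (Dg - 1) * ((Dg - 1) * (2 * (X ^ b.length * X))) * X :=
              Nat.mul_le_mul_right _ (Nat.mul_le_mul hx' h1)
          _ = ((Dg - 1) * (Dg - 1)) * (2 * (X ^ b.length * X * X)) := by ring
          _ ≤ (Dg * Dg) * (2 * (X ^ b.length * X * X)) := Nat.mul_le_mul_right _ hDD
          _ = 2 * (Dg * Dg) * (X ^ b.length * X * X) := by ring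
      have h3 : X * low' * (X * X) ≤ 2 * a.length * (Dg * Dg) * (X ^ b.length * X * X) := by
        have := Nat.mul_le_mul_right X hbound
        calc X * low' * (X * X) = (low' * (X * X)) * X := by ring
          _ ≤ _ := this.trans_eq (by ring)
      calc (x * packR X (e :: b) + X * low') * (X * X)
          = x * packR X (e :: b) * (X * X) + X * low' * (X * X) := by ring
        _ ≤ 2 * (Dg * Dg) * (X ^ b.length * X * X) + 2 * a.length * (Dg * Dg) * (X ^ b.length * X * X) :=
            Nat.add_le_add h2 h3
        _ = 2 * (a.length + 1) * (Dg * Dg) * (X ^ b.length * X * X) := by ring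

/-- **Digit extraction**: `(packF a · packR b / X^{|b|-1}) mod X = dotP a b` under the no-carry
conditions (digits `< Dg`, `2 |a| Dg² < X`, `X ≥ 2`). -/
theorem kron_extract (X Dg : ℕ) (hX : 2 ≤ X) (a b : List ℕ) (ha : ∀ d ∈ a, d < Dg) (hb : ∀ d ∈ b, d < Dg)
    (hlen : 2 * a.length * (Dg * Dg) < X) :
    extractK X (packF X a) (packR X b) (X ^ (b.length - 1)) = dotP a b := by
  change (packF X a * packR X b) / X ^ (b.length - 1) % X = dotP a b
  rcases b with _ | ⟨y, b⟩
  · simp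
  obtain ⟨low, hi, hprod, hbound⟩ := kron_split X Dg hX a (y :: b) ha hb (List.cons_ne_nil y b)
  have hXpos : 0 < X := by omega
  have hpow : 0 < X ^ ((y :: b).length - 1) := Nat.pow_pos hXpos
  have hlow : low < X ^ ((y :: b).length - 1) := by
    -- low * X² ≤ 2|a|Dg² X^{|b|} < X · X^{|b|} = X^{|b|-1} · X²
    rw [List.length_cons, Nat.add_sub_cancel] at *
    have h1 : low * (X * X) < X * X ^ (b.length + 1) :=
      hbound.trans_lt (Nat.mul_lt_mul_of_pos_right hlen (Nat.pow_pos hXpos))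
    rw [show X * X ^ (b.length + 1) = X ^ b.length * (X * X) by rw [pow_succ]; ring] at h1
    exact Nat.lt_of_mul_lt_mul_right h1
  have hdot : dotP a (y :: b) < X :=
    lt_of_le_of_lt (dotP_le Dg a (y :: b) ha hb) (by nlinarith [Nat.zero_le (a.length * (Dg * Dg))])
  rw [hprod]
  have e1 : (low + X ^ ((y :: b).length - 1) * (dotP a (y :: b) + X * hi)) / X ^ ((y :: b).length - 1)
      = dotP a (y :: b) + X * hi := by
    rw [Nat.add_mul_div_left _ _ hpow, Nat.div_eq_of_lt hlow, zero_add]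
  rw [e1, Nat.add_mul_mod_self_left, Nat.mod_eq_of_lt hdot]

/-- The decoded integer dot product in terms of the four prefix dot products. -/
theorem dotL_unoffset_eq (B : ℕ) : ∀ (a b : List ℕ),
    dotL (unoffset B a) (unoffset B b) =
      (dotP a b : ℤ) + (dotP (ones a) (ones b) : ℤ) * (B * B) - B * ((dotP a (ones b) : ℤ) + dotP (ones a) b)
  | [], b => by cases b <;> simp [unoffset, dotL]
  | x :: a, [] => by simp [unoffset, dotL]
  | x :: a, y :: b => by
    have ih := dotL_unoffset_eq B a b
    simp only [unoffset, List.map_cons, dotL, List.zipWith_cons_cons, List.sum_cons] at ih ⊢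
    rw [ih]
    simp only [ones_cons, dotP_cons]
    push_cast
    ring

/-- The packed dot product equals the integer dot product of the decoded rows. -/
theorem dotK_eq (X B Dg : ℕ) (hX : 2 ≤ X) (hDg : 2 ≤ Dg) (a b : List ℕ) (ha : ∀ d ∈ a, d < Dg)
    (hb : ∀ d ∈ b, d < Dg) (hlen : 2 * a.length * (Dg * Dg) < X) :
    dotK X B (B * B) (rowK X a) (rowK X b) = dotAcc (unoffset B a) (unoffset B b) 0 := by
  have h1 : ∀ d ∈ ones a, d < Dg := by
    intro d hd; simp only [ones, List.mem_map] at hd; obtain ⟨_, _, rfl⟩ := hd; omega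
  have h2 : ∀ d ∈ ones b, d < Dg := by
    intro d hd; simp only [ones, List.mem_map] at hd; obtain ⟨_, _, rfl⟩ := hd; omega
  have hlen' : 2 * (ones a).length * (Dg * Dg) < X := by rwa [length_ones]
  have k1 := kron_extract X Dg hX a b ha hb hlen
  have k2 := kron_extract X Dg hX a (ones b) ha h2 hlen
  have k3 := kron_extract X Dg hX (ones a) (ones b) h1 h2 hlen'
  have k4 := kron_extract X Dg hX (ones a) b h1 hb hlen'
  rw [length_ones] at k2 k3
  rw [dotAcc_eq, zero_add, dotL_unoffset_eq]
  unfold dotK rowK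
  simp only [Nat.add_eq, Nat.mul_eq, Nat.pow_eq]
  rw [repunit_eq_packR_ones X b, repunit_eq_packF_ones X a, k1, k2, k3, k4, Int.subNatNat_eq_coe]
  push_cast
  ring

/-! ### Equivalence with the integer programs -/
/-- Rows are no longer than `maxLenN`. -/
theorem length_le_maxLenN (L : List (List ℕ)) (r : List ℕ) (h : r ∈ L) : r.length ≤ maxLenN L := by
  induction L with
  | nil => simp at h
  | cons r0 rs ih =>
    simp only [maxLenN, List.map_cons, List.foldr_cons] at *
    rcases List.mem_cons.1 h with rfl | h'
    · exact le_max_left _ _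
    · exact (ih h').trans (le_max_right _ _)
/-- Congruence for `zipWith` from pointwise equality on the members of the first list. -/
theorem zipWith_congr_mem {α β γ : Type*} (f f' : α → β → γ) :
    ∀ (l : List α) (l' : List β), (∀ a ∈ l, ∀ b, f a b = f' a b) → List.zipWith f l l' = List.zipWith f' l l'
  | [], _, _ => by simp
  | _ :: _, [], _ => by simp
  | a :: l, b :: l', h => by
    rw [List.zipWith_cons_cons, List.zipWith_cons_cons, h a (by simp) b,
      zipWith_congr_mem f f' l l' (fun x hx => h x (by simp [hx]))]
/-- Unpacked side conditions. -/
theorem ok_spec (g : GramBlkK) (h : g.ok = true) :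
    g.L.length = g.z.length ∧ g.BB = g.B * g.B ∧ 2 ≤ g.X ∧ 2 ≤ g.Dg ∧
      (∀ r ∈ g.L, ∀ d ∈ r, d < g.Dg) ∧ 2 * maxLenN g.L * (g.Dg * g.Dg) < g.X := by
  unfold GramBlkK.ok at h
  simp only [Bool.and_eq_true, beq_iff_eq, decide_eq_true_eq, List.all_eq_true] at h
  obtain ⟨⟨⟨⟨⟨h1, h2⟩, h3⟩, h4⟩, h5⟩, h6⟩ := h
  exact ⟨h1, h2, h3, h4, h5, h6⟩

/-- `quadRowsK` computes the same term list as `quadRows` on the decoded block. -/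
theorem quadRowsK_eq (g : GramBlkK) (h : g.ok = true) (i0 cnt : ℕ) :
    quadRowsK g i0 cnt = quadRows g.toGramBlk i0 cnt := by
  obtain ⟨_, hBB, hX, hDg, hdig, hmax⟩ := ok_spec g h
  have key : ∀ ri ∈ g.L, ((g.L.map (rowK g.X)).map fun bj => dotK g.X g.B g.BB (rowK g.X ri) bj) =
      (g.L.map (unoffset g.B)).map fun rj => dotAcc (unoffset g.B ri) rj 0 := by
    intro ri hri
    rw [List.map_map, List.map_map]
    refine List.map_congr_left fun rj hrj => ?_
    simp only [Function.comp_apply]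
    rw [hBB]
    exact dotK_eq g.X g.B g.Dg hX hDg ri rj (hdig ri hri) (hdig rj hrj)
      (lt_of_le_of_lt (Nat.mul_le_mul_right _ (Nat.mul_le_mul_left _ (length_le_maxLenN g.L ri hri))) hmax)
  unfold quadRowsK quadRows GramBlkK.toGramBlk
  rw [← List.map_drop, ← List.map_take, ← List.map_drop, ← List.map_take, List.zipWith_map_left,
    List.zipWith_map_left]
  congr 1
  refine zipWith_congr_mem _ _ _ _ fun ri hri zi => ?_
  have hri' : ri ∈ g.L := List.mem_of_mem_drop (List.mem_of_mem_take hri)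
  rw [key ri hri']

/-- A successful packed chunk check is a successful chunk check of the decoded block. -/
theorem chunkOK_of_okK (g : GramBlkK) (i0 cnt : ℕ) (Dprev Dnext : SPoly)
    (h : chunkOKK g i0 cnt Dprev Dnext = true) : chunkOK g.toGramBlk i0 cnt Dprev Dnext = true := by
  unfold chunkOKK at h
  simp only [Bool.and_eq_true, decide_eq_true_eq] at h
  obtain ⟨⟨hok, hle⟩, hres⟩ := h
  have hlen := (ok_spec g hok).1
  unfold chunkOK
  simp only [Bool.and_eq_true, decide_eq_true_eq]
  refine ⟨⟨?_, hle⟩, ?_⟩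
  · unfold GramBlk.lenOK GramBlkK.toGramBlk
    simpa [List.length_map] using hlen
  · rw [← quadRowsK_eq g hok]; exact hres
/-- Chunk validity (`ThreePointCert.Soundness.ChunkVal`) of the decoded block from a packed
kernel chunk check. -/
theorem chunkVal_of_okK (g : GramBlkK) (i0 cnt : ℕ) (Dprev Dnext : SPoly)
    (h : chunkOKK g i0 cnt Dprev Dnext = true) : ChunkVal g.toGramBlk i0 cnt Dprev Dnext :=
  chunkVal_of_ok _ _ _ _ _ (chunkOK_of_okK g i0 cnt Dprev Dnext h)
/-- `RValid` of the decoded block from a single packed chunk check. -/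
theorem rvalid_of_singleK (g : GramBlkK) (R : SPoly)
    (h : chunkOKK g 0 g.z.length [] R = true) : RValid g.toGramBlk R :=
  chunkVal_of_okK g 0 g.z.length [] R h

end Summit.Ventures.PackingBounds.ThreePointCert

end
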